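import Literature.MathematicalPhysics.QuantumFieldTheory.Balaban1983to89.B8Thm4ExistsAtGamma
import Literature.MathematicalPhysics.QuantumFieldTheory.Balaban1983to89.B8Ineq133CubeMemberGamma
import Literature.MathematicalPhysics.QuantumFieldTheory.Balaban1983to89.B8DentedCubeMemberLamBPrime

/-!
# `Balaban1983to89.B8Prop6DentedCubeMemberGamma` — [Balaban1985RegularSpaces] PROPOSITION 6 (p. 99) ∕ [Balaban1985Variational] (152)–(153) p. 301 AT THE DENTED CUBE
# MEMBER, BACKGROUND `1`, MODULO the three existence BODIES at the datum — EDITION γ (dented twin of `B8CubeMemberZd` §3 + `B8Ineq133CubeMemberGamma` §3 +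
# `B8Prop6CubeMemberFlat3Gamma`: the datum translations, «the assumptions of Theorem 4 are satisfied for the pair 1, U₀″» on the dented tower, and the γ driver run there)

statement-level skeleton of published theorems with citation tags; proofs where landed; nothing here is a claim about the
Yang–Mills mass gap

`[Balaban1985RegularSpaces]` ("B8" = [6], CMP **99** (1985) 75–102): Prop. 6 (1.135)–(1.138) p. 99, p. 99 (the paragraph after (1.133): «If 7dL²Mα₀ ≤ c₁, then the assumptions of
Theorem 4 are satisfied for the pair of configurations 1, U₀″»), (1.132)–(1.133) p. 99, Thm 4 p. 88, (1.19)–(1.20) p. 79, (1.33)–(1.35) p. 82, (1.31) p. 82, (1.58)–(1.59) p. 86,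
(1.66) p. 87, (1.6) p. 77; `[Balaban1985Variational]` ("[15]", CMP **102** (1985) 277–309): p. 300–301, (148)–(153) («Now we have U′_k ∈ 𝔄_k({Ω′_j}, ε₀L³) ∩ Ax_k(𝔅′_k, 1), and
|Ū′ʲ_k − 1| < 6dL²Mε₀ on Ω′_j^{(j)} (151) … Theorem 2 … applied to U_k, 1 … ū_j = 1 on Λ′_j (152) … R ∂*A = 0 (153), R is defined for the sequence {Ω′_j}»);
`[Balaban1984PropagatorsII]` (2.3) p. 224.  PDF held: `paper:balaban1985-cmp99-regular-spaces-gauge-fixing`, `paper:balaban1985-cmp102-variational-background` (pp. 24–25).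

CITATION HEADER (lean-in-tree rule).  Cell `pub-ymgap` (YM Track A, HUMAN RULING D-0062), DAG node N05 = [B8], seat `pub-ymgap-dag-n05-e` (g31; FAN-OUT §N05 row s3b, Proposition-6
lane; (β) road, dag-n05-c standing GO on dented twins I.42366).  WHY THIS FILE.  [15] p. 301 applies [6] Theorem 2 (the tree: the Theorem-4 driver, Proposition 6's road) to
the pair `U_k, 1` ON THE LOCAL SEQUENCE `{Ω′_j}` of (148)–(150) — the DENTED tower of NODE 00's `CubeB8D` (p655171).  This seat's γ re-assembly proves [6] Proposition 6 at a PURE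
cube by running the sequence-generic γ driver `B8Thm4ExistsAtGamma.thm4Exists_concrete_at_γ` at `(cubeFam false, cubeLamS, cubeLamBP')` (`B8Prop6CubeMemberFlat3Gamma`);
THIS FILE runs the same driver at the dented member `(c.sq, c.lamST, c.lamBPT)` (laws: `B8DentedCubeMemberLamBPrime`), after translating the p. 99 ∕ (151) datum «U₀″ ∈
𝔄_k({□_j}, L³α₀) ∩ Ax_k(ℭ_k, 1), |Ū₀″ʲ − 1| < 6dL²Mα₀» (certified for the PURE tower by `B8Eq131Cubes.ineq132_cubes` ∕ `B8Ineq133`) to the dented tower: `𝔄_k` w.r.t. the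
SMALLER family `{Ω′_j}` (`Ω′_j ⊆ □_j`, `B8Ineq132.condAt_anti`), `Ax` w.r.t. the dented truncated cells (every dented cell lies under a pure cell — the dent's level-`(k−1)`
labels under their level-`k` parents in `□_k^{(k)}` — `B8CubeMemberZd.inAx_of_cover`), (1.35)∕(1.66) for boxes in `Ω′_{j−1} ⊆ □_{j−1}`.

WHAT THIS MODULE PROVES (kernel, 0 sorry; `c : Node00.CubeB8D d L K Ω`; `𝔸` a non-trivial C⋆-algebra).
§1 DATUM TRANSLATIONS (twin of `B8CubeMemberZd` §3): `lamST_cover_pure` (every dented truncated cell lies under a PURE top cell `Λ_{j′}`, `j ≤ j′ ≤ k`), ★ `inAx_lamST_of_inAx_top`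
   (`Ax_k` w.r.t. the pure cells ⟹ `Ax_m` w.r.t. `c.lamST m` for every `m ≤ k`), `inAk_sq_of_inAk_cubeFam` (`𝔄_k({□_j}) ⊆ 𝔄_k({Ω′_j})`).
§2 ★ `thm4_hypotheses_one_cutFixed_dented_γ` — the six conjuncts of `B8Ineq133CubeMemberGamma.thm4_hypotheses_one_cutFixed_γ` ON THE DENTED TOWER (`Ω := c.sq`, `Λs := c.lamST`;
   `□̃ ⊂ Ω_{k−1}` and `11d < M` are fields of `c`).
§3 ★★ `prop6_exists_dentedMember_at_γ₃` — PROPOSITION 6 ∕ (152)–(153) AT THE DENTED MEMBER, BACKGROUND `1`, MODULO THE THREE EXISTENCE BODIES at the flat datum `(1, U₀″)`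
   (Prop. 5 base ∕ step on the dented tower, the scalar γ four-line (1.59) clause with averaging index `c.lamBPT m ∪ {level-0 crossing bonds of □₀}`) — the statement of
   `prop6_exists_cubeMember_at_γ₃` with `cubeFam false ↦ c.sq`, `cubeLamS ↦ c.lamST` (`c.lamS` at the top), `cubeLamBP' ↦ c.lamBPT`; conclusion: a unitary `u`, `= 1` off
   `□₀`, with (1.29)∕(152) `ū_j = 1` on the DENTED cells `Λ′_j`, `U₁ = U₀″^{u⁻¹}` in the Landau gauge of record for `{Ω′_j}` ((153)), the (1.62)-shape of `A` on the sides
   touching `Ω′_j`, `w = v⁻¹u` unitary and (1.135) on `□̃` — i.e. the first seven conjuncts of `Node00.GaugedBoundB8D` in raw letters (the norms (1.136)₂–₄ and (1.137) are the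
   sequel twins, as in the pure chain).
HONEST SCOPE.  MODULO the three displayed bodies at the dented member (to be discharged by the dented twins of the flat line: `SockHFP59Gamma`-type Prop.-5 servers on the dented
tower and the scalar (1.59)♭ clause from the named facts `Ineq159FlatDentedCubeMemberPrinted` p659892 ∕ `GBoundDentedCubeMemberPrinted`); nothing of [6]∕[15] asserted beyond
what the driver proves; `≤` for print's `<`; `ℤᵈ` carriers.  Count-neutral; N05 ∕ N07 NOT discharged; one finite `T⁴` programme at fixed `ε`, Bałaban as printed; nothing
continuum ∕ ℝ⁴ ∕ OS ∕ mass-gap ∕ Clay.  No `sorry`, no `def`, no `instance`, no `notation`.  Unit `pub-ymgap-dag-n05-e` (g31), 2026-08-28.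

RELATED IN THE TREE, NOT DUPLICATED: `B8Prop6CubeMemberFlat3Gamma.prop6_exists_cubeMember_at_γ₃` (this seat g10; PURE member — the model), `B8Thm4ExistsAtGamma.thm4Exists_concrete_at_γ`
(this seat; the γ driver — USED BY NAME), `B8Ineq133CubeMemberGamma.thm4_hypotheses_one_cutFixed_γ` (dag-n05-c; USED), `B8CubeMemberZd.{cubeLamS_cover, inAx_of_cover,
inAx_cubeLamS_of_inAxOne}` (dag-n05-c; USED), `B8DentedCubeMemberZd` ∕ `B8DentedCubeMemberLamBPrime` (this seat g31; the dented member and its laws — USED),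
`Node00.CarriersB8CubeDented` (p655171).
-/

noncomputable section

open NormedSpace

namespace Literature.MathematicalPhysics.QuantumFieldTheory.Balaban1983to89.B8Prop6DentedCubeMemberGamma

open B7Prop1Explicit B7Prop2Explicit B7Prop1Local B7Eq92Concrete B8Ineq130
open B7Prop2Explicit (C0 c2')
open B8Ineq132 (covDerivFwd InAk pdevOn_lt_of_inAk BondTouches Under condAt_anti avgIter_one)
open B8Ineq133 (cutFixed)
open B8Eq115GaugeFixing (localGauge)
open B8Eq119TwistedAxial (InAx Restr129)
open B8Eq184Proof (gaugeExp cfgExp)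
open B8Lemma1NonAbelian (mulCfg)
open B8Eq140Level (SideTouches)
open B8Eq146AExpansion (iEta)
open B7Prop4GeneralLevels (linCovIter)
open B8Eq155JBound (Jcur wsup)
open B8ScaledSupNorm (bondNorm msup)
open B8Thm2LogB (blockTop)
open B8Eq138LandauZd (IsLandau138W logCfg)
open B8Eq131Cubes (cube tcube tLo tHi ctr tLo_le_tHi sqLo sqHi inLo inHi mem_cube_iff)
open B8Eq131CubesAdmissible (cubeFam cubeFam_false_zero smul_mem_cube_succ_iff)
open B8Eq131Derivation (under_zero_iff)
open B8Prop6OfThm4 (one_inAk localGauge_mem agree135)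
open B8CubeMemberZd (cubeLamS cubeLam cubeLamS_top cubeLamS_self cubeLamS_cover inAx_of_cover under_smul_iff)
open B8Ineq133CubeMemberGamma (thm4_hypotheses_one_cutFixed_γ)
open B8Thm4ExistsAtGamma (thm4Exists_concrete_at_γ)
open B9SupplySockB9P3ZdBeta (CrossB)
open B8DentedCubeMemberZd (lamST_of_lt lamST_top hΩ_sq)
open B8DentedCubeMemberLamBPrime (lamBPT_hbox_pred lamBPT_hclass bdryLayer_dented)
open Node00 (CubeB8D)

export B7Prop1Explicit (Site)

variable {d : ℕ}

/-! ## §1 The datum translations for «the assumptions of Theorem 4 are satisfied for the pair 1, U₀″» at the dented member -/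

section Datum

variable {L K : ℕ} {Ω : ℕ → Set (Site d)} (c : CubeB8D d L K Ω)

/-- **EVERY DENTED TRUNCATED CELL LIES UNDER A PURE TOP CELL** ((1.6) «Ω_j^{(j)} = ⋃_{l ≥ j} B^{l−j}(Λ_l)»): for `m ≤ k`, `j ≤ m` and `x_j ∈ c.lamST m j` there are `j ≤ j′ ≤ k`
and `y ∈ Λ_{j′}` (the PURE member's top cells `cubeLamS … k k j′ = cubeLam … j′`) with `x_j ∈ B^{j′−j}(y)` — below the top by dag-n05-c's `cubeLamS_cover`; at the top a
dented cell of level `≤ k − 2` or `k` is a pure cell, and a level-`(k−1)` dented cell is either a pure cell (off `□_k^{(k−1)}`) or a DENT label, which lies under its level-`k`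
parent in `□_k^{(k)} = Λ_k`. [cite: Balaban1985RegularSpaces, (1.6) p.77, (1.68) p.88, (1.131) p.99; Balaban1985Variational, (148)–(150) p.301] -/
theorem lamST_cover_pure (hL : 1 ≤ L) :
    ∀ m, m ≤ c.k → ∀ j, 1 ≤ j → j ≤ m → ∀ xj ∈ c.lamST m j,
      ∃ j', j ≤ j' ∧ j' ≤ c.k ∧ ∃ y ∈ cubeLamS L c.a c.M c.ρ c.k c.k j', Under L (j' - j) y xj := by
  intro m hm j _ hjm xj hxj
  have hk := c.one_le_k
  rcases lt_or_eq_of_le hm with hlt | heq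
  · rw [lamST_of_lt c hlt] at hxj
    exact cubeLamS_cover hL c.a c.M c.ρ c.k m hm j hjm xj hxj
  · subst heq
    rw [lamST_top c] at hxj
    have hself : Under L (j - j) xj xj := by rw [Nat.sub_self]; exact (under_zero_iff L xj xj).2 rfl
    rcases Nat.lt_or_ge (j + 1) c.k with hll | hge
    · refine ⟨j, le_rfl, hjm, xj, ?_, hself⟩
      rw [cubeLamS_top L c.a c.M c.ρ hjm, ← c.lamS_of_succ_lt hll]; exact hxj
    · rcases lt_or_eq_of_le hjm with hlt | heq
      · -- `j = k − 1`
        have hj : j = c.k - 1 := by omega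
        subst hj
        rw [c.mem_lamS_pred_iff] at hxj
        obtain ⟨hsq, -⟩ := hxj
        by_cases hin : InBox (inLo L c.a c.ρ c.k (c.k - 1)) (inHi L c.a c.M c.ρ c.k (c.k - 1)) xj
        · -- a DENT label: under its level-`k` parent in `□_k^{(k)}`
          have hsm := (smul_mem_cube_succ_iff hL c.a c.M c.ρ hlt xj).2 hin
          rw [show c.k - 1 + 1 = c.k by omega] at hsm
          obtain ⟨y, hy, hU⟩ := (mem_cube_iff hL).1 hsm
          refine ⟨c.k, hlt.le, le_rfl, y, by rw [cubeLamS_self]; exact hy, ?_⟩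
          rw [show c.k - (c.k - 1) = 1 by omega]
          have hU' : Under L (1 + (c.k - 1)) y (((L : ℤ) ^ (c.k - 1)) • xj) := by
            rw [show 1 + (c.k - 1) = c.k by omega]; exact hU
          exact (under_smul_iff hL 1 (c.k - 1) y xj).1 hU'
        · refine ⟨c.k - 1, le_rfl, by omega, xj, ?_, hself⟩
          rw [cubeLamS_top L c.a c.M c.ρ (by omega)]
          exact ⟨hsq, fun _ => hin⟩
      · subst heq
        exact ⟨c.k, le_rfl, le_rfl, xj, c.lamS_top_subset hxj, hself⟩

variable {𝔸 : Type*} [NormedRing 𝔸] [NormedAlgebra ℂ 𝔸] [CompleteSpace 𝔸]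

/-- ★ **`Ax_k` W.R.T. THE PURE CELLS FEEDS THE DRIVER ON THE DENTED TOWER AT EVERY TRUNCATION**: `InAx L k (cubeLamS … k) U₀ W` (the form (1.132)'s `Ax_k(ℭ_k, 1)` yields at
the pure member, `B8CubeMemberZd.inAx_cubeLamS_of_inAxOne`) gives `InAx L m (c.lamST m) U₀ W` for every `m ≤ k` (`inAx_of_cover` + `lamST_cover_pure`; [15] (151): «U′_k ∈ …
∩ Ax_k(𝔅′_k, 1)» for the local sequence). [cite: Balaban1985RegularSpaces, (1.132) p.99, (1.19)–(1.20) p.79, (1.6) p.77; Balaban1985Variational, (151) p.301] -/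
theorem inAx_lamST_of_inAx_top (hL : 1 ≤ L) {U₀ W : Site d → Fin d → 𝔸ˣ} (h : InAx L c.k (cubeLamS L c.a c.M c.ρ c.k c.k) U₀ W) :
    ∀ m, m ≤ c.k → InAx L m (c.lamST m) U₀ W :=
  fun m hm => inAx_of_cover (fun j hj1 hjm xj hxj => lamST_cover_pure c hL m hm j hj1 hjm xj hxj) h

omit [CompleteSpace 𝔸] in
/-- **`𝔄_k({□_j}, α) ⊆ 𝔄_k({Ω′_j}, α)`**: the dented members are SMALLER (`Ω′_j ⊆ □_j`, `CubeB8D.sq_subset_cubeFam`), so the plaquette∕bond conditions (1.7)–(1.9) over them are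
fewer (`B8Ineq132.condAt_anti`). [cite: Balaban1985RegularSpaces, (1.7)–(1.9) p.77, (1.132) p.99; Balaban1985Variational, (151) p.301 («U′_k ∈ 𝔄_k({Ω′_j}, ε₀L³)»)] -/
theorem inAk_sq_of_inAk_cubeFam {η α : ℝ} {V : Site d → Fin d → 𝔸ˣ} (h : InAk L c.k η α (cubeFam false L c.a c.M c.ρ c.k) V) :
    InAk L c.k η α c.sq V :=
  fun j hj => condAt_anti (c.sq_subset_cubeFam j) (h j hj)

end Datum

/-! ## §2 «The assumptions of Theorem 4 are satisfied for the pair 1, U₀″» ON THE DENTED TOWER — γ currency -/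

section Hypotheses

variable {L K : ℕ} {Ω : ℕ → Set (Site d)}
variable {𝔸 : Type*} [CStarAlgebra 𝔸] [Nontrivial 𝔸]

/-- ★ **THE p. 99 ∕ (151) SENTENCE AT THE DENTED MEMBER IN THE CURRENCY OF THE γ DRIVER**: the six conjuncts of `B8Ineq133CubeMemberGamma.thm4_hypotheses_one_cutFixed_γ` with
`Ω := c.sq`, `Λs := c.lamST` — `U₀″` unitary-valued; (1.33) for `1` on `{Ω′_j}`; (1.34)∕(151) `U₀″ ∈ 𝔄_k({Ω′_j}, L³α₀)` (from `𝔄_k({□_j}, L³α₀)`, §1); `Ax` at every truncation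
w.r.t. the dented cells (§1); (1.35)∕(1.66) for every level-`j` bond whose box lies in `Ω′_{j−1} ⊆ □_{j−1}`; (1.66) on the level-0 collar of `Ω′₀ = □₀`.  `□̃ ⊂ Ω_{k−1}`,
`L ≤ ρ ≤ M`, `11d < M` are the fields of `c`. [cite: Balaban1985RegularSpaces, p.99 (sentence after (1.133)), (1.132)–(1.133) p.99, (1.33)–(1.35) p.82, (1.66) p.87; Balaban1985Variational, (151) p.301] -/
theorem thm4_hypotheses_one_cutFixed_dented_γ (hL : 2 ≤ L) (hd : 1 ≤ d) (c : CubeB8D d L K Ω)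
    (U : Site d → Fin d → 𝔸ˣ) (hU : ∀ x κ, U x κ ∈ unitaryUnits 𝔸) {α₀ : ℝ} (hα : 0 < α₀)
    (hα3 : C0 d * (α₀ * (L : ℝ) ^ 2) ≤ 1 / 3) (hα2 : 2 * (α₀ * (L : ℝ) ^ 2) ≤ c2' d L)
    {η : ℝ} (hη : 0 < η) (hA : InAk L c.k η α₀ Ω U)
    (hsmall : 11 * (d : ℝ) ^ 2 * (L : ℝ) ^ 2 * α₀ + ((c.M : ℝ) + 4 * c.ρ) * d * (L : ℝ) ^ 2 * α₀ ≤ 1 / 6) :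
    (∀ x κ, cutFixed L (tLo c.a c.ρ) (tHi c.a c.M c.ρ) U c.k (ctr c.a c.M) x κ ∈ unitaryUnits 𝔸) ∧
    InAk L c.k η ((L : ℝ) ^ 3 * α₀) c.sq (1 : Site d → Fin d → 𝔸ˣ) ∧
    InAk L c.k η ((L : ℝ) ^ 3 * α₀) c.sq (mulCfg (cutFixed L (tLo c.a c.ρ) (tHi c.a c.M c.ρ) U c.k (ctr c.a c.M)) (1 : Site d → Fin d → 𝔸ˣ)) ∧
    (∀ m, m ≤ c.k → InAx L m (c.lamST m) (1 : Site d → Fin d → 𝔸ˣ)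
      (mulCfg (cutFixed L (tLo c.a c.ρ) (tHi c.a c.M c.ρ) U c.k (ctr c.a c.M)) (1 : Site d → Fin d → 𝔸ˣ))) ∧
    (∀ j, j ≤ c.k → ∀ (z : Site d) (μ : Fin d),
      (∀ x, InBox (loK L j z) (bondHiK L j z μ) x → x ∈ c.sq (j - 1)) →
        ‖(avgIter L (mulCfg (cutFixed L (tLo c.a c.ρ) (tHi c.a c.M c.ρ) U c.k (ctr c.a c.M)) (1 : Site d → Fin d → 𝔸ˣ)) j z μ : 𝔸) -
            (avgIter L (1 : Site d → Fin d → 𝔸ˣ) j z μ : 𝔸)‖ ≤ 6 * d * (L : ℝ) ^ 2 * c.M * α₀) ∧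
    (∀ b ∈ {b : Site d × Fin d | SideTouches (c.sq 0) b.1 b.2},
      ‖((cutFixed L (tLo c.a c.ρ) (tHi c.a c.M c.ρ) U c.k (ctr c.a c.M) b.1 b.2 : 𝔸ˣ) : 𝔸) - 1‖ ≤ 6 * d * (L : ℝ) ^ 2 * c.M * α₀) := by
  have hL1 : 1 ≤ L := le_trans (by norm_num) hL
  have hρ : 1 ≤ c.ρ := hL1.trans c.L_le_ρ
  have hM : 11 * (d : ℝ) < c.M := by exact_mod_cast c.big
  have hLpos : (0 : ℝ) < L := by exact_mod_cast lt_of_lt_of_le (by norm_num) hL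
  have hα₀' : 0 < (L : ℝ) ^ 3 * α₀ := by positivity
  obtain ⟨hmem, -, h34, hAx, h135, h66⟩ :=
    thm4_hypotheses_one_cutFixed_γ L hL hd c.k U hU hα hα3 hα2 c.a hρ c.ρ_le_M hM hη hA c.tcube_sub hsmall
  refine ⟨hmem, one_inAk hL1 c.k hη hα₀' c.sq, inAk_sq_of_inAk_cubeFam c h34, inAx_lamST_of_inAx_top c hL1 (hAx c.k le_rfl),
    fun j hj z μ hbox => h135 j hj z μ (fun x hx => c.sq_subset_cubeFam (j - 1) (hbox x hx)), fun b hb => h66 b ?_⟩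
  have hb' : SideTouches (c.sq 0) b.1 b.2 := hb
  rw [c.sq_zero, ← cubeFam_false_zero L c.a c.M c.ρ c.k] at hb'
  exact hb'

end Hypotheses

/-! ## §3 PROPOSITION 6 ∕ (152)–(153) at the dented member, background `1`, modulo the three existence bodies — edition γ -/

section Prop6

variable {L : ℕ}
variable {𝔸 : Type} [CStarAlgebra 𝔸] [Nontrivial 𝔸]

/-- ★★ **PROPOSITION 6 (p. 99) ∕ [15] (152)–(153) AT THE DENTED CUBE MEMBER, MODULO THE THREE EXISTENCE BODIES AT THE FLAT DATUM `(1, U₀″)`, EDITION γ** — the statement of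
`B8Prop6CubeMemberFlat3Gamma.prop6_exists_cubeMember_at_γ₃` on [15]'s local sequence `{Ω′_j}`: tower `c.sq`, truncated cells `c.lamST` (`c.lamS` at the top), averaging index of
the (1.59) body `c.lamBPT m ∪ {level-0 crossing bonds of □₀}`; the side conditions `L ≤ ρ ≤ M`, `11d < M`, `□̃ ⊂ Ω_{k−1}` are the fields of `c`, the ambient family `{Ω_j}` is `c`'s.
ONE threshold `c₁ > 0` (the γ driver's); for every dented datum at which the three bodies hold, every unitary `U₀ ∈ 𝔄_k({Ω_j}, α₀)` in the regime of (1.130) with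
`L³α₀ + 6dL²Mα₀ ≤ c₁`: THERE IS a unitary `u`, `= 1` off `□₀`, with (1.29)∕(152) «ū_j = 1 on Λ′_j» for the DENTED cells, such that `U₁ := U₀″^{u⁻¹}` satisfies the Landau gauge
of record (1.38)∕(153) for `{Ω′_j}` and (1.62): `U₁ = e^{iηA}`, `A` Hermitian, `|A_b| ≤ 5dLB₀(L³α₀ + 6dL²Mα₀)(Lʲη)⁻¹` on the bonds of the plaquettes touching `Ω′_j`; and (1.135):
`w := v⁻¹u` unitary, `U₀^{w⁻¹} = U₁` on `□̃`.  Driver `thm4Exists_concrete_at_γ` fed by `lamBPT_hbox_pred ∕ lamBPT_hclass ∕ bdryLayer_dented` and §2.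
[cite: Balaban1985RegularSpaces, Prop. 6 (1.135)–(1.136) p.99, p.99 (sentence after (1.133)), Thm 4 p.88 (existence), Prop. 5 (1.107)–(1.108) p.94, (1.58)–(1.59) p.86, (1.31) p.82; Balaban1985Variational, (148)–(153) p.301; Balaban1984PropagatorsII, (2.3) p.224] -/
theorem prop6_exists_dentedMember_at_γ₃ (hd2 : 2 ≤ d) {L : ℕ} (hL : 2 ≤ L) {B₀ B₀' Bbd : ℝ} (hB₀ : 0 < B₀) (hB₀' : 0 < B₀')
    (hB : 2 ≤ 5 * (d : ℝ) * L * B₀) (hBbd : 0 ≤ Bbd) (hBd : 4 * Bbd ≤ ((d : ℝ) * L - 1) * B₀) :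
    ∃ c₁ : ℝ, 0 < c₁ ∧ ∀ (η : ℝ), 0 < η → ∀ {K : ℕ} {Ω : ℕ → Set (Site d)} (c : CubeB8D d L K Ω),
      ∀ (U₀ : Site d → Fin d → 𝔸ˣ), (∀ x κ, U₀ x κ ∈ unitaryUnits 𝔸) → ∀ (α₀ : ℝ), 0 < α₀ →
      C0 d * (α₀ * (L : ℝ) ^ 2) ≤ 1 / 3 → 2 * (α₀ * (L : ℝ) ^ 2) ≤ c2' d L →
      InAk L c.k η α₀ Ω U₀ →
      11 * (d : ℝ) ^ 2 * (L : ℝ) ^ 2 * α₀ + ((c.M : ℝ) + 4 * c.ρ) * d * (L : ℝ) ^ 2 * α₀ ≤ 1 / 6 →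
      (L : ℝ) ^ 3 * α₀ + 6 * d * (L : ℝ) ^ 2 * c.M * α₀ ≤ c₁ →
      ((∃ (v : Site d → 𝔸ˣ) (lam : Site d → 𝔸), (∀ x, v x ∈ unitaryUnits 𝔸) ∧ (∀ x, x ∉ c.sq 0 → v x = 1) ∧
        (∀ j, j ≤ 1 → ∀ b ∈ {b : Site d × Fin d | SideTouches (c.sq j) b.1 b.2}, (v b.1 : 𝔸) = ((gaugeExp lam b.1 : 𝔸ˣ) : 𝔸) ∧
        (v (b.1 + e b.2) : 𝔸) = ((gaugeExp lam (b.1 + e b.2) : 𝔸ˣ) : 𝔸)) ∧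
        (∀ j, j ≤ 1 → ∀ b ∈ {b : Site d × Fin d | SideTouches (c.sq j) b.1 b.2},
        ‖lam b.1‖ ≤ (8 * B₀' * (5 * (d : ℝ) * L * B₀) * (((L : ℝ) ^ 3 * α₀) + (6 * d * (L : ℝ) ^ 2 * c.M * α₀))) ∧
          ((L : ℝ) ^ j * η) * ‖covDerivFwd η (1 : Site d → Fin d →
          𝔸ˣ) b.2 lam b.1‖ ≤ (8 * B₀' * (5 * (d : ℝ) * L * B₀) * (((L : ℝ) ^ 3 * α₀) + (6 * d * (L : ℝ) ^ 2 * c.M * α₀)))) ∧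
        IsLandau138W L 1 η (c.sq 0) (c.lamST 1) (1 : Site d → Fin d → 𝔸ˣ) (mgauge (1 : Site d → Fin d →
          𝔸ˣ) v⁻¹ (cutFixed L (tLo c.a c.ρ) (tHi c.a c.M c.ρ) U₀ c.k (ctr c.a c.M))) ∧ Restr129 L 1 (c.lamST 1) (1 : Site d → Fin d → 𝔸ˣ) ((1 : Site d →
          𝔸ˣ) * v))) →
      ((∀ m, 1 ≤ m → m < c.k → ∀ (u₁ : Site d → 𝔸ˣ) (U₁ : Site d → Fin d → 𝔸ˣ) (A : Site d → Fin d → 𝔸),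
        (∀ x, u₁ x ∈ unitaryUnits 𝔸) → (∀ x, x ∉ c.sq 0 → u₁ x = 1) → mgauge (1 : Site d → Fin d →
          𝔸ˣ) u₁ U₁ = (cutFixed L (tLo c.a c.ρ) (tHi c.a c.M c.ρ) U₀ c.k (ctr c.a c.M)) → Restr129 L m (c.lamST m) (1 : Site d → Fin d → 𝔸ˣ) u₁ →
        IsLandau138W L m η (c.sq 0) (c.lamST m) (1 : Site d → Fin d → 𝔸ˣ) U₁ →
        (∀ j, j ≤ m → ∀ b ∈ {b : Site d × Fin d | SideTouches (c.sq j) b.1 b.2},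
        U₁ b.1 b.2 = cfgExp η A b.1 b.2 ∧ IsSelfAdjoint (A b.1 b.2) ∧
          ‖A b.1 b.2‖ ≤ (5 * (d : ℝ) * L * B₀ * (((L : ℝ) ^ 3 * α₀) + (6 * d * (L : ℝ) ^ 2 * c.M * α₀))) * ((L : ℝ) ^ j * η)⁻¹) →
        ∃ (v : Site d → 𝔸ˣ) (lam : Site d → 𝔸), (∀ x, v x ∈ unitaryUnits 𝔸) ∧ (∀ x, x ∉ c.sq 0 → v x = 1) ∧
        (∀ j, j ≤ m + 1 →
          ∀ b ∈ {b : Site d × Fin d | SideTouches (c.sq j) b.1 b.2}, (v b.1 : 𝔸) = ((gaugeExp lam b.1 : 𝔸ˣ) : 𝔸) ∧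
        (v (b.1 + e b.2) : 𝔸) = ((gaugeExp lam (b.1 + e b.2) : 𝔸ˣ) : 𝔸)) ∧
        (∀ j, j ≤ m + 1 → ∀ b ∈ {b : Site d × Fin d | SideTouches (c.sq j) b.1 b.2},
        ‖lam b.1‖ ≤ (8 * B₀' * (5 * (d : ℝ) * L * B₀) * (((L : ℝ) ^ 3 * α₀) + (6 * d * (L : ℝ) ^ 2 * c.M * α₀))) ∧
          ((L : ℝ) ^ j * η) * ‖covDerivFwd η (1 : Site d → Fin d →
          𝔸ˣ) b.2 lam b.1‖ ≤ (8 * B₀' * (5 * (d : ℝ) * L * B₀) * (((L : ℝ) ^ 3 * α₀) + (6 * d * (L : ℝ) ^ 2 * c.M * α₀)))) ∧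
        IsLandau138W L (m + 1) η (c.sq 0) (c.lamST (m + 1)) (1 : Site d → Fin d → 𝔸ˣ) (mgauge (1 : Site d → Fin d →
          𝔸ˣ) v⁻¹ U₁) ∧ Restr129 L (m + 1) (c.lamST (m + 1)) (1 : Site d → Fin d → 𝔸ˣ) (u₁ * v))) →
      ((∀ m, 1 ≤ m → m ≤ c.k → ∀ (u : Site d → 𝔸ˣ) (W : Site d → Fin d → 𝔸ˣ) (A' : Site d → Fin d → 𝔸),
        (∀ x, u x ∈ unitaryUnits 𝔸) → (∀ x, x ∉ c.sq 0 → u x = 1) →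
          mgauge (1 : Site d → Fin d → 𝔸ˣ) u W = (cutFixed L (tLo c.a c.ρ) (tHi c.a c.M c.ρ) U₀ c.k (ctr c.a c.M)) →
          Restr129 L m (c.lamST m) (1 : Site d → Fin d → 𝔸ˣ) u →
          IsLandau138W L m η (c.sq 0) (c.lamST m) (1 : Site d → Fin d → 𝔸ˣ) W →
        (∀ y τ, IsSelfAdjoint (A' y τ)) →
        (∀ j, j ≤ m → ∀ y τ, SideTouches (c.sq j) y τ →
        W y τ = cfgExp η A' y τ ∧
          ‖A' y τ‖ ≤ (2 * (L * (5 * (d : ℝ) * L * B₀ * (((L : ℝ) ^ 3 * α₀) + (6 * d * (L : ℝ) ^ 2 * c.M * α₀)))) + 8 * (8 * B₀' * (5 * (d : ℝ) * L * B₀) * (((L : ℝ) ^ 3 * α₀) + (6 * d * (L : ℝ) ^ 2 * c.M * α₀)))) * ((L : ℝ) ^ j * η)⁻¹) →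
        (∀ y τ, (∀ j, j ≤ m → ¬ SideTouches (c.sq j) y τ) → A' y τ = 0) →
        msup L m η (-(1 : ℝ)) (fun j (b : Site d × Fin d) => SideTouches (c.sq j) b.1 b.2) (fun b => A' b.1 b.2)
        ≤ B₀ * (bondNorm L m η (-(3 : ℝ)) c.sq (fun x μ => Jcur η (1 : Site d → Fin d → 𝔸ˣ) A' μ x)
        + wsup 1 (fun p : {p : ℕ × (Site d × Fin d) // p.1 ≤ m ∧ (p.2 ∈ c.lamBPT m p.1 ∨ (p.1 = 0 ∧ CrossB (c.sq 0) p.2))} =>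
        linCovIter L (1 : Site d → Fin d → 𝔸ˣ) (iEta η A') p.1.1 p.1.2.1 p.1.2.2))
        + Bbd * msup L m η (-(1 : ℝ)) (fun j (b : Site d × Fin d) => j = 0 ∧ SideTouches (c.sq 0) b.1 b.2 ∧
            ¬ BondTouches (c.sq 0) b.1 b.2) (fun b => A' b.1 b.2) ∧
        msup L m η (-(2 : ℝ)) (fun j (t : Fin d × Fin d × Site d) => SideTouches (c.sq j) t.2.2 t.2.1)
        (fun t => covDerivFwd η (1 : Site d → Fin d → 𝔸ˣ) t.1 (fun z => A' z t.2.1) t.2.2)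
        ≤ B₀ * (bondNorm L m η (-(3 : ℝ)) c.sq (fun x μ => Jcur η (1 : Site d → Fin d → 𝔸ˣ) A' μ x)
        + wsup 1 (fun p : {p : ℕ × (Site d × Fin d) // p.1 ≤ m ∧ (p.2 ∈ c.lamBPT m p.1 ∨ (p.1 = 0 ∧ CrossB (c.sq 0) p.2))} =>
        linCovIter L (1 : Site d → Fin d → 𝔸ˣ) (iEta η A') p.1.1 p.1.2.1 p.1.2.2))
        + Bbd * msup L m η (-(1 : ℝ)) (fun j (b : Site d × Fin d) => j = 0 ∧ SideTouches (c.sq 0) b.1 b.2 ∧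
            ¬ BondTouches (c.sq 0) b.1 b.2) (fun b => A' b.1 b.2))) →
      ∃ u : Site d → 𝔸ˣ, (∀ x, u x ∈ unitaryUnits 𝔸) ∧ (∀ x, x ∉ c.sq 0 → u x = 1) ∧
        Restr129 L c.k c.lamS (1 : Site d → Fin d → 𝔸ˣ) u ∧
        IsLandau138W L c.k η (c.sq 0) c.lamS (1 : Site d → Fin d → 𝔸ˣ)
          (gaugeAct u⁻¹ (cutFixed L (tLo c.a c.ρ) (tHi c.a c.M c.ρ) U₀ c.k (ctr c.a c.M))) ∧
        (∀ j, j ≤ c.k → ∀ b ∈ {b : Site d × Fin d | SideTouches (c.sq j) b.1 b.2},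
          gaugeAct u⁻¹ (cutFixed L (tLo c.a c.ρ) (tHi c.a c.M c.ρ) U₀ c.k (ctr c.a c.M)) b.1 b.2 =
              cfgExp η (logCfg η (gaugeAct u⁻¹ (cutFixed L (tLo c.a c.ρ) (tHi c.a c.M c.ρ) U₀ c.k (ctr c.a c.M)))) b.1 b.2 ∧
            IsSelfAdjoint (logCfg η (gaugeAct u⁻¹ (cutFixed L (tLo c.a c.ρ) (tHi c.a c.M c.ρ) U₀ c.k (ctr c.a c.M))) b.1 b.2) ∧
            ‖logCfg η (gaugeAct u⁻¹ (cutFixed L (tLo c.a c.ρ) (tHi c.a c.M c.ρ) U₀ c.k (ctr c.a c.M))) b.1 b.2‖ ≤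
              (5 * (d : ℝ) * L * B₀ * ((L : ℝ) ^ 3 * α₀ + 6 * d * (L : ℝ) ^ 2 * c.M * α₀)) * ((L : ℝ) ^ j * η)⁻¹) ∧
        (∀ x, ((localGauge L (tLo c.a c.ρ) (tHi c.a c.M c.ρ) U₀ c.k (ctr c.a c.M))⁻¹ * u) x ∈ unitaryUnits 𝔸) ∧
        AgreeOn (tlo L (tLo c.a c.ρ) c.k) (thi L (tHi c.a c.M c.ρ) c.k)
          (gaugeAct ((localGauge L (tLo c.a c.ρ) (tHi c.a c.M c.ρ) U₀ c.k (ctr c.a c.M))⁻¹ * u)⁻¹ U₀)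
          (gaugeAct u⁻¹ (cutFixed L (tLo c.a c.ρ) (tHi c.a c.M c.ρ) U₀ c.k (ctr c.a c.M))) := by
  have hL1 : 1 ≤ L := le_trans (by norm_num) hL
  have hd1 : 1 ≤ d := le_trans (by norm_num) hd2
  obtain ⟨c₁, hc₁, H⟩ := thm4Exists_concrete_at_γ (𝔸 := 𝔸) hd2 hL hB₀ hB₀' hB hBbd hBd
  refine ⟨c₁, hc₁, ?_⟩
  intro η hη K Ω c U₀ hU₀ α₀ hα hα3 hα2 hA hsmall hc P5base₁ P5step₁ H59Dβ₁
  have hk : 1 ≤ c.k := c.one_le_k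
  have hρ : 1 ≤ c.ρ := hL1.trans c.L_le_ρ
  have hM1 : 1 ≤ c.M := hρ.trans c.ρ_le_M
  have hLpos : (0 : ℝ) < L := by exact_mod_cast lt_of_lt_of_le (by norm_num) hL
  have hdpos : (0 : ℝ) < d := by exact_mod_cast hd1
  have hMpos : (0 : ℝ) < c.M := by exact_mod_cast hM1
  have hα₀' : 0 < (L : ℝ) ^ 3 * α₀ := by positivity
  have hα₁' : 0 < 6 * (d : ℝ) * (L : ℝ) ^ 2 * c.M * α₀ := by positivity
  obtain ⟨hmem, h33, h34, hAx, h135, h66⟩ :=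
    thm4_hypotheses_one_cutFixed_dented_γ hL hd1 c U₀ hU₀ hα hα3 hα2 hη hA hsmall
  have hone : ∀ x κ, (1 : Site d → Fin d → 𝔸ˣ) x κ ∈ unitaryUnits 𝔸 := fun _ _ => (unitaryUnits 𝔸).one_mem
  obtain ⟨u, hu, huS, h129, hLan, h162⟩ := H η hη c.k c.sq (hΩ_sq c) c.lamST c.lamBPT (lamBPT_hbox_pred c hL1) (lamBPT_hclass c hL1)
    (bdryLayer_dented c hL) _ _ hα₀' hα₁' hc 1 _ hone hmem h33 h34 hAx h135 h66 P5base₁ P5step₁ H59Dβ₁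
  simp only [mgauge_one_left] at hLan h162
  rw [lamST_top c] at h129 hLan
  have hΩ' : ∃ l, l ≤ c.k ∧ c.k ≤ l + 1 ∧ ∀ x, InBox (tlo L (tLo c.a c.ρ) c.k) (thi L (tHi c.a c.M c.ρ) c.k) x → x ∈ Ω l :=
    ⟨c.k - 1, Nat.sub_le _ _, by omega, fun x hx => c.tcube_sub hx⟩
  have hvG : ∀ x, localGauge L (tLo c.a c.ρ) (tHi c.a c.M c.ρ) U₀ c.k (ctr c.a c.M) x ∈ unitaryUnits 𝔸 :=
    localGauge_mem L hL (avgClosed_unitaryUnits (𝔸 := 𝔸) d L) c.k U₀ hU₀ hα hα3 hα2 (tLo_le_tHi hM1)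
      (pdevOn_lt_of_inAk hL1 hα hA hΩ') (ctr c.a c.M)
  exact ⟨u, hu, huS, h129, hLan hk, h162, fun x => (unitaryUnits 𝔸).mul_mem ((unitaryUnits 𝔸).inv_mem (hvG x)) (hu x),
    agree135 _ _ U₀ _ u⟩

#print axioms prop6_exists_dentedMember_at_γ₃

end Prop6

end Literature.MathematicalPhysics.QuantumFieldTheory.Balaban1983to89.B8Prop6DentedCubeMemberGamma

end
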